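import Literature.MathematicalPhysics.QuantumManyBody.GroundState
import HarnessLib

/-!
# Crux `GroundStateRigidity` (stmt-AtomisticToContinuum-9072), line `Sketch`:
# the registered stub `stub_truncDiagonal`

Supports (does not close) stmt-AtomisticToContinuum-9072; stub `stub_truncDiagonal` (Stub 15e)
of line Sketch. **Diagonal near-optimal trial states.** If the closed energies of `Ψ` for a
sequence of pair profiles `w m` are all `≤ S < ⊤`, then for every `m` there is a trial state
`Φ m` with `energy (w m) (Φ m) ≤ S + 1/(m+1)` and `∫ |Φ m - Ψ|² ≤ 1/(m+1)`.

## Proof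

Fix `m` and put `ε = ((m : ℝ≥0∞) + 1)⁻¹ > 0`. Since `closedEnergy (w m) L Ψ ≤ S < S + ε`
(`S ≠ ⊤`), unfolding the double infimum defining `closedEnergy` (`iInf_lt_iff` twice) yields a
sequence `Θ` of trial states with `Θ → Ψ` in `L²` and `liminfₙ energy (w m) (Θ n) < S + ε`.
Hence frequently `energy (w m) (Θ n) < S + ε` (`frequently_lt_of_liminf_lt`), while eventually
`∫ |Θ n - Ψ|² ≤ ε` (`Tendsto.eventually_le_const`); a common index `n`
(`Frequently.and_eventually`) gives `Φ m := Θ n`, and `choose` assembles the sequence.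
-/

noncomputable section

open MeasureTheory Filter Set Metric
open scoped ENNReal NNReal Topology

namespace Summit.AtomisticToContinuum.BoseEinsteinCondensation.Theorems.GroundStateRigidity

open Literature.MathematicalPhysics.QuantumManyBody.BoseGas

namespace TruncDiagonal

variable {N : ℕ} {v : ℝ → ℝ≥0∞} {L : ℝ} {Ψ : Config N → ℂ}

/-- **One near-optimal trial state.** If `q̄_v[Ψ] < T` and `0 < ε`, there is a trial state `Φ`
with `energy v Φ < T` and `∫ |Φ - Ψ|² ≤ ε`: unfold the infimum defining the closed energy, then
pick an index where the energy is (frequently) below `T` and the `L²` distance is (eventually)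
at most `ε`. [cite: Kato1966, VI §1.4 Thm 1.17] -/
theorem exists_trialState_energy_lt_of_closedEnergy_lt {T ε : ℝ≥0∞}
    (hT : closedEnergy v L Ψ < T) (hε : 0 < ε) :
    ∃ Φ : TrialState N L, energy v Φ < T ∧ ∫⁻ X, (‖Φ.ψ X - Ψ X‖₊ : ℝ≥0∞) ^ 2 ≤ ε := by
  obtain ⟨Θ, hΘ⟩ := iInf_lt_iff.1 hT
  obtain ⟨hΘΨ, hlim⟩ := iInf_lt_iff.1 hΘ
  have hfreq : ∃ᶠ n in atTop, energy v (Θ n) < T := frequently_lt_of_liminf_lt (h := hlim)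
  have hev : ∀ᶠ n in atTop, ∫⁻ X, (‖(Θ n).ψ X - Ψ X‖₊ : ℝ≥0∞) ^ 2 ≤ ε :=
    Tendsto.eventually_le_const hε hΘΨ
  obtain ⟨n, hn, hn'⟩ := (hfreq.and_eventually hev).exists
  exact ⟨Θ n, hn, hn'⟩

end TruncDiagonal

/-! ### The stub -/

open TruncDiagonal in
/-- **Stub `stub_truncDiagonal` of line `Sketch` — diagonal near-optimal trial states.** If
`q̄_{w m}[Ψ] ≤ S < ⊤` for all `m`, there are trial states `Φ m` with
`energy (w m) (Φ m) ≤ S + 1/(m+1)` and `∫ |Φ m - Ψ|² ≤ 1/(m+1)`: for each `m`,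
`q̄_{w m}[Ψ] < S + 1/(m+1)`, so the infimum defining the closed energy is undercut by an
approximating sequence, along which the energy is frequently `< S + 1/(m+1)` and the `L²`
distance eventually `≤ 1/(m+1)` (`TruncDiagonal.exists_trialState_energy_lt_of_closedEnergy_lt`);
`choose` over `m`. [cite: Kato1966, VI §1.4 Thm 1.17] -/
theorem stub_truncDiagonal :
    ∀ (N : ℕ) (L : ℝ) (w : ℕ → ℝ → ℝ≥0∞) (Ψ : Config N → ℂ) (S : ℝ≥0∞),
      (∀ m : ℕ, closedEnergy (w m) L Ψ ≤ S) → S ≠ ⊤ →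
      ∃ Φ : ℕ → TrialState N L, (∀ m : ℕ, energy (w m) (Φ m) ≤ S + ((m : ℝ≥0∞) + 1)⁻¹) ∧
        ∀ m : ℕ, ∫⁻ X, (‖(Φ m).ψ X - Ψ X‖₊ : ℝ≥0∞) ^ 2 ≤ ((m : ℝ≥0∞) + 1)⁻¹ := by
  intro N L w Ψ S hS hST
  have key : ∀ m : ℕ, ∃ Φ : TrialState N L, energy (w m) Φ ≤ S + ((m : ℝ≥0∞) + 1)⁻¹ ∧
      ∫⁻ X, (‖Φ.ψ X - Ψ X‖₊ : ℝ≥0∞) ^ 2 ≤ ((m : ℝ≥0∞) + 1)⁻¹ := by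
    intro m
    have hε : ((m : ℝ≥0∞) + 1)⁻¹ ≠ 0 :=
      ENNReal.inv_ne_zero.2 (ENNReal.add_ne_top.2 ⟨ENNReal.natCast_ne_top m, ENNReal.one_ne_top⟩)
    have hlt : closedEnergy (w m) L Ψ < S + ((m : ℝ≥0∞) + 1)⁻¹ :=
      (hS m).trans_lt (ENNReal.lt_add_right hST hε)
    obtain ⟨Φ, hΦ, hΦ'⟩ :=
      exists_trialState_energy_lt_of_closedEnergy_lt hlt (pos_iff_ne_zero.2 hε)
    exact ⟨Φ, hΦ.le, hΦ'⟩
  choose Φ hΦ using key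
  exact ⟨Φ, fun m => (hΦ m).1, fun m => (hΦ m).2⟩

end Summit.AtomisticToContinuum.BoseEinsteinCondensation.Theorems.GroundStateRigidity

end
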